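import Summits.QuantumFields.YangMills.Theorems.BalabanUVNodesN27AtRecord11
import Summits.QuantumFields.YangMills.Theorems.BalabanUVNodesSpineCarriersOfRecord13Sep
import Summits.QuantumFields.YangMills.Theorems.BalabanUVNodesRateCarriersOfRecord13Sep

/-!
# BalabanUVNodes ∕ N27 = binder B5 AT THE RECORD, XXXVIII⁗ — N27 AT THE SEPARATED STAGE-13 CARRIER HOMES OF RECORD: B5 `Spine ₁₃CSep` from the one-application stub instances at
# (T-SPINE)₁₃⁗ `YMDAG.UVSplit.SRec₁₃Sep cr` (dag-n20-d lineage, `…SpineCarriersOfRecord13Sep`) and (T-RATE)₁₃⁗ `YMDAG.UVSplit.RRec₁₃Sep 𝔯` (dag-n22-e 1″⁗ `…RateCarriersOfRecord13Sep` p503408 ✓,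
# keyed by RR-2's canonical datum key `Node00.IsDatumOfRecord₁₃CSep` ∕ `.params`, `Node00/Record13DatumKeySep.lean` p502881 ✓) and the N19′ edge AT THE HOMES' OWN KEYS — the K4 existence
# stub `S_R00x` DISCHARGED BY NAME (`s_R00x_rRec₁₃Sep`): THE ⁗ EDITION OF MODULE XXXVIII `…N27AtRecord13Home` (p494468 ✓) under def-T's v1.2 token map (`Provisos₁₃ ↦ Provisos₁₃Sep`,
# `datumOfRecord₁₃ ↦ datumOfRecord₁₃Sep`, `IsRecordOfRecord₁₃C ↦ IsRecordOfRecord₁₃CSep`) + RR-2's AFTER-C names + the carriers' stems (`SRec₁₃ ↦ SRec₁₃Sep`, `RRec₁₃ ↦ RRec₁₃Sep`,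
# `rateCarriersOfRecord₁₃ ↦ rateCarriersOfRecord₁₃Sep`); proofs verbatim under the map; my stems `…rec13C… ↦ …rec13CSep…`, `homes₁₃ ↦ homes₁₃Sep`
# (cell `pub-ymgap`, HUMAN RULING D-0062 Track A, R134 seat `pub-ymgap-dag-n27-c` (s2) gen 7; `--kind proof --supports stmt-QuantumFields-20292 --as helper` — K3⁗ `SpineGivenEndpointR13Sep`, dag-lead
# KEY MAP WORDS-140; COUNT-NEUTRAL; `N`-generic, NO Theses import — the route-facing `N = 2` line is module XXXVII⁗'s `spineGivenEndpointR13Sep_of_homes₁₃Sep` (append-only, once this module is on the olean))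

THE KNIT.  XIV `spine_of_rateStubs_coreEdge` at `Rec := Node00.IsRecordOfRecord₁₃CSep F N`, `SRec := SRec₁₃Sep cr`, `RRec := RRec₁₃Sep 𝔯`:
* `S_R00x ₁₃CSep (RRec₁₃Sep 𝔯)` — PROVED at the home (`YMDAG.UVSplit.s_R00x_rRec₁₃Sep`: the run-length-0 bundle at the record's own datum key; existence of residual objects is free),
  so it is NOT a hypothesis here;
* `S_N14`–`S_N18`, `S_N22` at `RRec₁₃Sep 𝔯` — the home's one-application instances (`s_N14_rRec₁₃Sep_iff` … `s_N22_rRec₁₃Sep_iff`), HYPOTHESES;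
* `S_N27x ₁₃CSep (SRec₁₃Sep cr)`, `S_N20`, `S_N21` at `SRec₁₃Sep cr` — the home's instances (`s_N27x_sRec₁₃Sep_of`, `s_N20_sRec₁₃Sep_iff`, `s_N21_sRec₁₃Sep_iff`), HYPOTHESES;
* the N19′ ∃δ-edge AT THE TWO HOMES' KEYS (`h19`): for every admissible Stage-13 `θ` with provisos, every `g₀`, `os`, every datum key `h : IsDatumOfRecord₁₃CSep F N (datumOfRecord₁₃Sep F N θ hP)`
  of θ's own datum and every run length `k`: the six rates at the CANONICAL rate bundle `rateCarriersOfRecord₁₃Sep 𝔯 F h.params h.provisos g₀ os k` give SOME summable `δ` carrying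
  `Spine.NE7.Core` on the shell-free cores of `cr F θ hP g₀ os` (`coreEdge_of_homes₁₃Sep`).

WHAT IS KERNEL-CHECKED ([bookkeeping]; 0 `def`, 0 `sorry`): `coreEdge_of_homes₁₃Sep` · **`spine_rec13CSep_of_homes₁₃Sep`** (the knit above ⇒ `Spine ₁₃CSep`) · `spine_rec13CSep_of_homes₁₃Sep_faces` (the same with
the spine-side stubs replaced by their θ-indexed readings through the home's faces: N20 `RelWeightBound` ∕ N21 `ShellWeightBound` at `cr F θ hP g₀ os`, N27x's unconditional θ-form).

HONEST FRAMING.  COMPOSITE-node bookkeeping: every K4∕K5 stub and the edge are HYPOTHESES with NO producer at the Stage-13 record today (0∕1; the children's ₁₃ re-keying is in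
progress); the readings `cr`, `𝔯` are PARAMETERS of the homes (no reading of Bałaban's dressed expansion ∕ dressed tower of record exists); `S_R00x` is discharged only because residual
objects exist by construction (located, not content); nothing of Bałaban's asserted; NE7 ∕ NE7b ∕ NE7c NOT PRINTED for d = 4 and NOT PROVED; NO node discharged; K3⁗ NOT claimed; no ₁₃
inhabitant claimed (K0⁗ open); counts UNMOVED (typed 28∕28 · discharged 5∕27, A 5∕28); one finite four-torus programme at fixed `ε` — NOT ℝ⁴, NOT infinite volume, NOT OS, NOT a mass
gap, NOT Clay.  No decl below carries a cite tag.
-/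

namespace Summit.QuantumFields.YangMills.Theorems.BalabanUVNodesN27SpineRecord

open Literature.MathematicalPhysics.QuantumFieldTheory.Balaban1983to89
open Literature.MathematicalPhysics.QuantumFieldTheory.Balaban1983to89.T4Continuum
open T4WeightBudget (RelWeightBound)
open T4IndicatorShell (ShellWeightBound)
open T4ContinuumYM4Torus (ForSmallCouplings)
open Summit.QuantumFields.BalabanUV.T4Continuum.Spine
open YMDAG.UVSplit
open Node00 (Stage13Params datumOfRecord₁₃Sep IsRecordOfRecord₁₃CSep IsDatumOfRecord₁₃CSep)

variable {N : ℕ} [NeZero N] (cr : SpineReading₁₃Sep N) (𝔯 : RateReading₁₃Sep N)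

/-! ## §1 The N19′ edge at the two homes' keys -/

/-- **XIV's N19′ EDGE AT `(SRec₁₃Sep cr, RRec₁₃Sep 𝔯)`**: a bundle pinned by `SRec₁₃Sep cr` is `cr F θ hP g₀ os` for an admissible θ with provisos realising `D`; rate carriers pinned by `RRec₁₃Sep 𝔯` at
the same `D` are a run length `k` of the canonical bundle at a datum key of `D`; so the edge XIV consumes is the HOME-KEYED pair form `h19`. [bookkeeping] -/
theorem coreEdge_of_homes₁₃Sep
    (h19 : ∀ (F : T4Family) (θ : Stage13Params F N) (hP : θ.Provisos₁₃Sep F N), θ.Admissible F N → ∀ (g₀ : ℕ → ℝ) (os : List (ULoop F))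
      (h : IsDatumOfRecord₁₃CSep F N (datumOfRecord₁₃Sep F N θ hP)) (k : ℕ),
      RatesAt (datumOfRecord₁₃Sep F N θ hP) (rateCarriersOfRecord₁₃Sep 𝔯 F h.params h.provisos g₀ os k) → letI := (cr F θ hP g₀ os).dec
        ∃ δ : ℕ → ℝ, NE7.Core (cr F θ hP g₀ os).l₀ (cr F θ hP g₀ os).vol (cr F θ hP g₀ os).T (cr F θ hP g₀ os).Bad
          (fun K t τ => (cr F θ hP g₀ os).A K t τ - (cr F θ hP g₀ os).shA K t τ) (fun K t τ => (cr F θ hP g₀ os).B K t τ - (cr F θ hP g₀ os).shB K t τ) δ ∧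
          Summable δ)
    (F : T4Family) (D : Datum F N) (g₀ : ℕ → ℝ) (os : List (ULoop F)) (S : SpineCarriers) (R : RateCarriers N)
    (hS : SRec₁₃Sep cr F D g₀ os S) (hR : RRec₁₃Sep 𝔯 F D g₀ os R) (hrates : RatesAt D R) : letI := S.dec
      ∃ δ : ℕ → ℝ, NE7.Core S.l₀ S.vol S.T S.Bad (fun K t τ => S.A K t τ - S.shA K t τ) (fun K t τ => S.B K t τ - S.shB K t τ) δ ∧ Summable δ := by
  obtain ⟨θ, hP, hθ, rfl, rfl⟩ := hS
  obtain ⟨h, k, rfl⟩ := hR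
  exact h19 F θ hP hθ g₀ os h k hrates

/-! ## §2 The knit at the homes -/

/-- **N27 = B5 AT THE STAGE-13 RECORD FROM THE STUB INSTANCES OF THE TWO CARRIER HOMES OF RECORD AND THE HOME-KEYED N19′ EDGE — `S_R00x` DISCHARGED BY NAME.**  XIV
`spine_of_rateStubs_coreEdge` at `(₁₃CSep, SRec₁₃Sep cr, RRec₁₃Sep 𝔯)` with `hx := s_R00x_rRec₁₃Sep 𝔯` (home theorem): the six K4 stubs at `RRec₁₃Sep 𝔯`, the three K5 stubs at `SRec₁₃Sep cr` and `h19` give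
`Spine ₁₃CSep`.  Every remaining stub a HYPOTHESIS (0∕1 today). [bookkeeping] -/
theorem spine_rec13CSep_of_homes₁₃Sep (h14 : S_N14 (RRec₁₃Sep 𝔯)) (h15 : S_N15 (RRec₁₃Sep 𝔯)) (h16 : S_N16 (RRec₁₃Sep 𝔯)) (h17 : S_N17 (RRec₁₃Sep 𝔯))
    (h18 : S_N18 (RRec₁₃Sep 𝔯)) (h22 : S_N22 (RRec₁₃Sep 𝔯)) (hx' : S_N27x (fun F D w => IsRecordOfRecord₁₃CSep F N D w) (SRec₁₃Sep cr)) (h20 : S_N20 (SRec₁₃Sep cr))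
    (h21 : S_N21 (SRec₁₃Sep cr))
    (h19 : ∀ (F : T4Family) (θ : Stage13Params F N) (hP : θ.Provisos₁₃Sep F N), θ.Admissible F N → ∀ (g₀ : ℕ → ℝ) (os : List (ULoop F))
      (h : IsDatumOfRecord₁₃CSep F N (datumOfRecord₁₃Sep F N θ hP)) (k : ℕ),
      RatesAt (datumOfRecord₁₃Sep F N θ hP) (rateCarriersOfRecord₁₃Sep 𝔯 F h.params h.provisos g₀ os k) → letI := (cr F θ hP g₀ os).dec
        ∃ δ : ℕ → ℝ, NE7.Core (cr F θ hP g₀ os).l₀ (cr F θ hP g₀ os).vol (cr F θ hP g₀ os).T (cr F θ hP g₀ os).Bad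
          (fun K t τ => (cr F θ hP g₀ os).A K t τ - (cr F θ hP g₀ os).shA K t τ) (fun K t τ => (cr F θ hP g₀ os).B K t τ - (cr F θ hP g₀ os).shB K t τ) δ ∧
          Summable δ) :
    Spine (N := N) fun F D w => IsRecordOfRecord₁₃CSep F N D w :=
  spine_of_rateStubs_coreEdge _ (SRec₁₃Sep cr) (RRec₁₃Sep 𝔯) (s_R00x_rRec₁₃Sep 𝔯) h14 h15 h16 h17 h18 h22 hx' h20 h21 (coreEdge_of_homes₁₃Sep cr 𝔯 h19)

/-- **THE SAME WITH THE SPINE-SIDE STUBS READ THROUGH THE HOME's FACES**: N20 `RelWeightBound` and N21 `ShellWeightBound` at `cr F θ hP g₀ os` for every admissible Stage-13 θ with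
provisos (`s_N20_sRec₁₃Sep_iff` ∕ `s_N21_sRec₁₃Sep_iff`), and N27x's unconditional θ-form (`s_N27x_sRec₁₃Sep_of`: positivity + E1∕E2 against the datum's dressed partition functions at every
admissible θ); rate stubs as in `spine_rec13CSep_of_homes₁₃Sep`. [bookkeeping] -/
theorem spine_rec13CSep_of_homes₁₃Sep_faces (h14 : S_N14 (RRec₁₃Sep 𝔯)) (h15 : S_N15 (RRec₁₃Sep 𝔯)) (h16 : S_N16 (RRec₁₃Sep 𝔯)) (h17 : S_N17 (RRec₁₃Sep 𝔯))
    (h18 : S_N18 (RRec₁₃Sep 𝔯)) (h22 : S_N22 (RRec₁₃Sep 𝔯))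
    (hx : ∀ (F : T4Family) (θ : Stage13Params F N) (hP : θ.Provisos₁₃Sep F N), θ.Admissible F N → ∀ (g₀ : ℕ → ℝ) (os : List (ULoop F)),
      0 < (cr F θ hP g₀ os).l₀ ∧ 0 < (cr F θ hP g₀ os).vol ∧
        (∀ (K : ℕ) (t : ℝ), |t| ≤ (cr F θ hP g₀ os).l₀ →
          T4GenFunBounds.schemeZ ((datumOfRecord₁₃Sep F N θ hP).scheme g₀) os ((cr F θ hP g₀ os).K₀ + K) t =
            ∑ τ ∈ (cr F θ hP g₀ os).T K, (cr F θ hP g₀ os).A K t τ) ∧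
        (∀ (K : ℕ) (t : ℝ), |t| ≤ (cr F θ hP g₀ os).l₀ →
          T4GenFunBounds.schemeZ ((datumOfRecord₁₃Sep F N θ hP).scheme g₀) os ((cr F θ hP g₀ os).K₀ + K + 1) t =
            ∑ τ ∈ (cr F θ hP g₀ os).T K, (cr F θ hP g₀ os).B K t τ))
    (h20 : ∀ (F : T4Family) (θ : Stage13Params F N) (hP : θ.Provisos₁₃Sep F N), θ.Admissible F N → ∀ (g₀ : ℕ → ℝ) (os : List (ULoop F)),
      RelWeightBound (cr F θ hP g₀ os).l₀ (cr F θ hP g₀ os).T (cr F θ hP g₀ os).A (cr F θ hP g₀ os).B (cr F θ hP g₀ os).Bad (cr F θ hP g₀ os).W)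
    (h21 : ∀ (F : T4Family) (θ : Stage13Params F N) (hP : θ.Provisos₁₃Sep F N), θ.Admissible F N → ∀ (g₀ : ℕ → ℝ) (os : List (ULoop F)),
      ShellWeightBound (cr F θ hP g₀ os).l₀ (cr F θ hP g₀ os).T (cr F θ hP g₀ os).A (cr F θ hP g₀ os).B (cr F θ hP g₀ os).shA (cr F θ hP g₀ os).shB
        (cr F θ hP g₀ os).Wsh)
    (h19 : ∀ (F : T4Family) (θ : Stage13Params F N) (hP : θ.Provisos₁₃Sep F N), θ.Admissible F N → ∀ (g₀ : ℕ → ℝ) (os : List (ULoop F))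
      (h : IsDatumOfRecord₁₃CSep F N (datumOfRecord₁₃Sep F N θ hP)) (k : ℕ),
      RatesAt (datumOfRecord₁₃Sep F N θ hP) (rateCarriersOfRecord₁₃Sep 𝔯 F h.params h.provisos g₀ os k) → letI := (cr F θ hP g₀ os).dec
        ∃ δ : ℕ → ℝ, NE7.Core (cr F θ hP g₀ os).l₀ (cr F θ hP g₀ os).vol (cr F θ hP g₀ os).T (cr F θ hP g₀ os).Bad
          (fun K t τ => (cr F θ hP g₀ os).A K t τ - (cr F θ hP g₀ os).shA K t τ) (fun K t τ => (cr F θ hP g₀ os).B K t τ - (cr F θ hP g₀ os).shB K t τ) δ ∧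
          Summable δ) :
    Spine (N := N) fun F D w => IsRecordOfRecord₁₃CSep F N D w :=
  spine_rec13CSep_of_homes₁₃Sep cr 𝔯 h14 h15 h16 h17 h18 h22 (s_N27x_sRec₁₃Sep_of cr hx) ((s_N20_sRec₁₃Sep_iff cr).mpr h20) ((s_N21_sRec₁₃Sep_iff cr).mpr h21) h19

end Summit.QuantumFields.YangMills.Theorems.BalabanUVNodesN27SpineRecord
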